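/-
Copyright (c) 2026 the pub-hodgecm-mathlib formalisation cell (harness21).  Prover seat hodgecm-mathlib-K2Liu-p10 (g7) (L1 hand placed on S8 by chair
K2-lead (g2) ACROSS-LINES VALVE 15 (i)), Track B ∕ K2-LIT, h413 = `stmt-HodgeConjecture-24833`, R90-TF section S8 «ContSpec-n½», the (M) «middle
residue» road, item (M-f)(ii) ISOTYPIC ALGEBRA (S8 dealer R90-CS-plan (g3), S8-R215 (1); K2E1-p10 (g5) census f283641be139b1c0).  Mathlib-only, THEOREMS ONLY.
-/
import Mathlib.RingTheory.SimpleModule.Isotypic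
import HarnessLib

/-!
# S8 (M) road, (M-f)(ii): ISOTYPIC ALGEBRA — a simple submodule ∕ quotient ∕ subquotient of an `S`-isotypic semisimple module `M ≅ ι →₀ S` is `S`

Track B ∕ K2-LIT, crux h413 = `stmt-HodgeConjecture-24833`, route of record `HCCMUnconditional`; cell `hodgecm-mathlib`, R90-TF programme, section S8
«ContSpec-n½», the (M) «middle residue» road (dealer R90-CS-plan (g3), S8-R212 ∕ S8-R215).  K2E1-p10 (g6)'s FILE 1 `R90S8ResMiddleResidueIsPiNOfLettersU3`
IMPORTS this file instead of proving (M-f)(ii) in place.  THEOREMS ONLY (no `def`, no `instance`, no `notation`, no named-fact hypothesis, no `sorry`; default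
heartbeats); lane `--supports stmt-HodgeConjecture-24833 --as helper` (count-neutral).  CLOSES NO SOCKET.  Pure module theory over an arbitrary ring `R`
(Mathlib's `IsIsotypicOfType`, `IsSemisimpleModule`, `IsSimpleModule`).

THE MATHEMATICS.  Let `S` be a simple `R`-module and `M ≅ ι →₀ S` (a direct sum of copies of `S`).  Then `M` is semisimple (Mathlib instance on `ι →₀ S`,
transported by `IsSemisimpleModule.congr`) and ISOTYPIC OF TYPE `S`: every simple submodule of `ι →₀ S` lies in `⨆ i, range (lsingle i) = ⊤`, a supremum of
copies of `S`, hence is isomorphic to one of them (Mathlib `Submodule.linearEquiv_of_le_sSup`).  Isotypy passes to submodules (`IsIsotypicOfType.of_injective`);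
in a semisimple module every quotient `M ⧸ p` is isomorphic to a complement of `p` (`IsSemisimpleModule.exists_submodule_linearEquiv_quotient`), so a SIMPLE
quotient is isomorphic to a simple submodule, hence to `S`; a simple SUBQUOTIENT `N₂ ⧸ (N₁ ⊓ N₂)` is a simple quotient of the semisimple isotypic submodule `N₂`.
* §1 **`isIsotypicOfType_finsupp_simple`** (`ι →₀ S` is `S`-isotypic), **`isIsotypicOfType_of_linearEquiv_finsupp`**, **`isSemisimpleModule_of_linearEquiv_finsupp`**;
* §2 **`nonempty_linearEquiv_quotient_of_isIsotypicOfType`** — a simple quotient of a semisimple `S`-isotypic module is `S` (the engine);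
* §3 the three heads the (M) file consumes, over `e : M ≃ₗ[R] (ι →₀ S)`: **`nonempty_linearEquiv_of_isotypic_submodule`** (every simple SUBMODULE `≅ S`),
  **`nonempty_linearEquiv_of_isotypic_quotient`** (every simple QUOTIENT `≅ S`), **`nonempty_linearEquiv_of_isotypic_subquotient`** (every simple SUBQUOTIENT
  `N₂ ⧸ comap N₂.subtype N₁ ≅ S`; the dealer's head bytes S8-R215 (1) — its hypothesis `N₁ ≤ N₂` is carried for the caller's shape and not needed by the proof,
  hence underscore-named).
§1's `finsupp` lemma is adapted from the cell's earlier (non-importable) `Summits/Ventures/HodgeRepro2/T5IsotypicProduct.lean` (`isIsotypicOfType_finsupp`).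
HONEST LABEL: HC_CM is proved only modulo the 7 printed citations (2 remaining named inputs: hLiu418 = `stmt-HodgeConjecture-24832`, h413 =
`stmt-HodgeConjecture-24833`) until rung 0 closes; REL ≠ ★ ≠ BUILT; this file asserts no named fact and closes no socket; count-neutral; unconditional.

## References
* [Jacobson1989BasicAlgebraII] N. Jacobson, *Basic Algebra II* (2nd ed., 1989), §3.5 (completely reducible modules; isotypic ∕ homogeneous components).
* [Lang2002] S. Lang, *Algebra* (rev. 3rd ed., GTM 211, 2002), XVII §1–§2, Prop. 1.2 and the isotypic decomposition.
* [AndersonFuller1992] F. W. Anderson, K. R. Fuller, *Rings and Categories of Modules* (2nd ed., GTM 13, 1992), §9 (semisimple modules; homogeneous components).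
-/

set_option autoImplicit false
set_option linter.dupNamespace false  -- the mandated namespace `…HodgeConjecture.HodgeConjecture.R90.S8` repeats the summit's segment

namespace Summit.HodgeConjecture.HodgeConjecture.R90.S8

variable {R : Type*} [Ring R] {M S : Type*} [AddCommGroup M] [Module R M] [AddCommGroup S] [Module R S]

/-! ## §1 `ι →₀ S` is semisimple and isotypic of type `S`; so is every module isomorphic to it -/

/-- **`ι →₀ S` IS ISOTYPIC OF TYPE `S`** for a simple `R`-module `S`: every simple submodule of the direct sum of copies of `S` is isomorphic to `S` (it lies in
`⨆ i, range (lsingle i) = ⊤`, a supremum of simple modules each `≅ S`, so Mathlib's `Submodule.linearEquiv_of_le_sSup` applies).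
[cite: Jacobson1989BasicAlgebraII, §3.5] [cite: Lang2002, XVII §1 Prop. 1.2] -/
theorem isIsotypicOfType_finsupp_simple {ι : Type*} [IsSimpleModule R S] : IsIsotypicOfType R (ι →₀ S) S := by
  -- adapted from Summits/Ventures/HodgeRepro2/T5IsotypicProduct.lean (`isIsotypicOfType_finsupp`), restated over Mathlib only
  intro m hm
  have ecopy : ∀ i : ι, S ≃ₗ[R] LinearMap.range (Finsupp.lsingle i : S →ₗ[R] (ι →₀ S)) := fun i =>
    LinearEquiv.ofInjective _ (LinearMap.ker_eq_bot.mp (Finsupp.ker_lsingle i))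
  have hs : m ≤ sSup (Set.range fun i : ι => LinearMap.range (Finsupp.lsingle i : S →ₗ[R] (ι →₀ S))) := by
    rw [sSup_range, Finsupp.iSup_lsingle_range]
    exact le_top
  haveI : ∀ T : Set.range (fun i : ι => LinearMap.range (Finsupp.lsingle i : S →ₗ[R] (ι →₀ S))), IsSimpleModule R T := by
    rintro ⟨T, i, rfl⟩
    exact IsSimpleModule.congr (ecopy i).symm
  obtain ⟨T, ⟨i, rfl⟩, ⟨e'⟩⟩ := Submodule.linearEquiv_of_le_sSup m _ hs
  exact ⟨e'.trans (ecopy i).symm⟩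

/-- A module isomorphic to `ι →₀ S` (`S` simple) is isotypic of type `S` (`IsIsotypicOfType.of_injective` along the isomorphism).
[cite: Jacobson1989BasicAlgebraII, §3.5] [cite: AndersonFuller1992, §9] -/
theorem isIsotypicOfType_of_linearEquiv_finsupp {ι : Type*} [IsSimpleModule R S] (e : M ≃ₗ[R] (ι →₀ S)) : IsIsotypicOfType R M S :=
  (isIsotypicOfType_finsupp_simple (R := R) (S := S) (ι := ι)).of_injective _ e.injective

/-- A module isomorphic to `ι →₀ S` (`S` simple) is semisimple (Mathlib's instance on `ι →₀ S`, transported by `IsSemisimpleModule.congr`).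
[cite: Lang2002, XVII §2] -/
theorem isSemisimpleModule_of_linearEquiv_finsupp {ι : Type*} [IsSimpleModule R S] (e : M ≃ₗ[R] (ι →₀ S)) : IsSemisimpleModule R M :=
  IsSemisimpleModule.congr e

/-! ## §2 The engine: a simple quotient of a semisimple `S`-isotypic module is `S` -/

/-- **A SIMPLE QUOTIENT OF A SEMISIMPLE `S`-ISOTYPIC MODULE IS `S`.**  In a semisimple module the quotient `M ⧸ p` is isomorphic to a submodule (a complement of
`p`, `IsSemisimpleModule.exists_submodule_linearEquiv_quotient`); that submodule is simple with `M ⧸ p`, hence `≅ S` by isotypy.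
[cite: Jacobson1989BasicAlgebraII, §3.5] [cite: Lang2002, XVII §2] -/
theorem nonempty_linearEquiv_quotient_of_isIsotypicOfType [IsSemisimpleModule R M] (h : IsIsotypicOfType R M S) (p : Submodule R M)
    [IsSimpleModule R (M ⧸ p)] : Nonempty ((M ⧸ p) ≃ₗ[R] S) := by
  obtain ⟨P, ⟨eP⟩⟩ := IsSemisimpleModule.exists_submodule_linearEquiv_quotient p
  haveI : IsSimpleModule R P := IsSimpleModule.congr eP
  exact ⟨eP.symm.trans (h P).some⟩

/-! ## §3 The heads the (M) file consumes: simple submodule ∕ quotient ∕ subquotient of `M ≅ ι →₀ S` is `S` -/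

/-- **EVERY SIMPLE SUBMODULE OF `M ≅ ι →₀ S` IS `S`** (`S` simple). [cite: Jacobson1989BasicAlgebraII, §3.5] [cite: Lang2002, XVII §1 Prop. 1.2] -/
theorem nonempty_linearEquiv_of_isotypic_submodule (hS : IsSimpleModule R S) {ι : Type*} (e : M ≃ₗ[R] (ι →₀ S)) (N : Submodule R M)
    (hN : IsSimpleModule R N) : Nonempty (N ≃ₗ[R] S) :=
  haveI := hS
  haveI := hN
  isIsotypicOfType_of_linearEquiv_finsupp e N

/-- **EVERY SIMPLE QUOTIENT OF `M ≅ ι →₀ S` IS `S`** (`S` simple). [cite: Jacobson1989BasicAlgebraII, §3.5] [cite: Lang2002, XVII §2] -/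
theorem nonempty_linearEquiv_of_isotypic_quotient (hS : IsSimpleModule R S) {ι : Type*} (e : M ≃ₗ[R] (ι →₀ S)) (N : Submodule R M)
    (hQ : IsSimpleModule R (M ⧸ N)) : Nonempty ((M ⧸ N) ≃ₗ[R] S) :=
  haveI := hS
  haveI := hQ
  haveI : IsSemisimpleModule R M := isSemisimpleModule_of_linearEquiv_finsupp e
  nonempty_linearEquiv_quotient_of_isIsotypicOfType (isIsotypicOfType_of_linearEquiv_finsupp e) N

/-- **EVERY SIMPLE SUBQUOTIENT OF `M ≅ ι →₀ S` IS `S`** (`S` simple; S8-R215 (1) head bytes): for submodules `N₁, N₂` of `M` with the quotient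
`N₂ ⧸ (N₁ ⊓ N₂)` (spelled `↥N₂ ⧸ Submodule.comap N₂.subtype N₁`) simple, that quotient is isomorphic to `S` — `N₂` is semisimple and `S`-isotypic as a
submodule of `M`, and §2 applies to its simple quotient.  The hypothesis `N₁ ≤ N₂` is part of the caller's shape only (underscore-named; the statement holds
without it). [cite: Jacobson1989BasicAlgebraII, §3.5] [cite: Lang2002, XVII §2] [cite: AndersonFuller1992, §9] -/
theorem nonempty_linearEquiv_of_isotypic_subquotient (hS : IsSimpleModule R S) {ι : Type*} (e : M ≃ₗ[R] (ι →₀ S)) (N₁ N₂ : Submodule R M)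
    (_h : N₁ ≤ N₂) (hQ : IsSimpleModule R (↥N₂ ⧸ Submodule.comap N₂.subtype N₁)) :
    Nonempty ((↥N₂ ⧸ Submodule.comap N₂.subtype N₁) ≃ₗ[R] S) := by
  haveI := hS
  haveI := hQ
  haveI : IsSemisimpleModule R M := isSemisimpleModule_of_linearEquiv_finsupp e
  -- `N₂` is semisimple (Mathlib instance `IsSemisimpleModule.submodule`) and `S`-isotypic along its injection into `M`
  have hiso : IsIsotypicOfType R N₂ S := (isIsotypicOfType_of_linearEquiv_finsupp e).of_injective _ N₂.subtype_injective
  exact nonempty_linearEquiv_quotient_of_isIsotypicOfType hiso _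

end Summit.HodgeConjecture.HodgeConjecture.R90.S8
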